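import Literature.Analysis.ValidatedNumerics.MatrixEigenEnclosure
import HarnessLib

/-!
# Certificates that an eigenvalue lies NEAR a given value (residual / Weinstein bound)

Topic `Literature/Analysis/ValidatedNumerics`. Complements the one-sided spectral enclosures of
`MatrixEigenEnclosure.lean` (`lam ≤ λᵢ ∀ i`, `∃ i, λᵢ ≤ μ`) by the two-sided enclosure of an
INDIVIDUAL (possibly interior) eigenvalue of every Hermitian matrix of an interval family: from a
rational approximate eigenpair `(μ, u)` the checker verifies, in exact rational arithmetic,
`‖(C − μ) u‖² ≤ ε₁² ‖u‖²` (residual of the centre) and `Σ_i (Σ_j Δ i j m j)² ≤ ε₂² ‖u‖²`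
(`m j = |Re u j| + |Im u j|`, the contribution of the radii), whence by the Weinstein bound
`min_k |λ_k − μ| · ‖u‖ ≤ ‖(H − μ) u‖` (`Literature.LinearAlgebra.Matrix.exists_abs_eigenvalues_sub_mul_norm_le`)
every Hermitian `H` with `‖H i j − (Cre + i Cim) i j‖ ≤ Δ i j` has an eigenvalue in
`[μ − (ε₁ + ε₂), μ + (ε₁ + ε₂)]`.

* `exists_abs_eigenvalues_sub_le_of_norm_residual_le` — the Weinstein bound in the form used here
  (any `RCLike` field): `‖H x − μ x‖ ≤ ε ‖x‖`, `x ≠ 0` ⇒ `∃ k, |λ_k − μ| ≤ ε`;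
* `checkNearHerm n Cre Cim Δ ure uim μ ε₁ ε₂` and its soundness
  `exists_abs_eigenvalues_sub_le_of_checkNearHerm` (complex Hermitian families);
* `checkNear n C Δ u μ ε₁ ε₂` (`= checkNearHerm` with empty imaginary tables) and
  `exists_abs_eigenvalues_sub_le_of_checkNear` (real symmetric families, stated for
  `A : Matrix (Fin n) (Fin n) ℝ` and `hA.eigenvalues`).

Emitting: `μ :=` a float eigenvalue rounded to the dyadic grid, `u :=` its float eigenvector
rounded, `ε₁ := ⌈‖(C − μ)u‖/‖u‖⌉`, `ε₂ := ⌈√(Σ_i (Σ_j Δ i j m j)²)/‖u‖⌉` (rounded up with a little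
slack). Everything here is proved; no named facts.

## References

* H. F. Weinberger, *Variational Methods for Eigenvalue Approximation*, SIAM (1974), §4.5
  (the Weinstein / Krylov–Bogoliubov enclosure `dist(μ, σ(H)) ≤ ‖Hu − μu‖/‖u‖`). [folklore]
* S. M. Rump, *Verification methods*, Acta Numerica 19 (2010), §13.4 (verified eigenpair bounds
  from a residual). [folklore]
-/

noncomputable section

open Finset Matrix WithLp

namespace Literature.Analysis.ValidatedNumerics

/-! ### The Weinstein bound, normalised -/

/-- **Weinstein bound**: if `x ≠ 0` and `‖H x − μ x‖ ≤ ε ‖x‖` for a Hermitian `H`, then some eigenvalue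
of `H` is within `ε` of `μ`. [folklore] -/
theorem exists_abs_eigenvalues_sub_le_of_norm_residual_le {𝕜 : Type*} [RCLike 𝕜] {m : Type*}
    [Fintype m] [DecidableEq m] {H : Matrix m m 𝕜} (hH : H.IsHermitian) (μ : ℝ)
    {x : EuclideanSpace 𝕜 m} (hx : x ≠ 0) {ε : ℝ}
    (h : ‖toEuclideanLin H x - (μ : 𝕜) • x‖ ≤ ε * ‖x‖) : ∃ k, |hH.eigenvalues k - μ| ≤ ε := by
  haveI : Nonempty m := by
    by_contra hm
    rw [not_nonempty_iff] at hm
    exact hx (Subsingleton.elim _ _)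
  obtain ⟨k, hk⟩ := Literature.LinearAlgebra.Matrix.exists_abs_eigenvalues_sub_mul_norm_le hH μ x
  exact ⟨k, le_of_mul_le_mul_right (hk.trans h) (norm_pos_iff.2 hx)⟩

/-! ### Elementary bounds used by the checker -/

/-- `‖a + b i‖ ≤ |a| + |b|`. [folklore] -/
theorem norm_complex_le_abs_add_abs (a b : ℝ) : ‖(a : ℂ) + (b : ℂ) * Complex.I‖ ≤ |a| + |b| := by
  refine (norm_add_le _ _).trans ?_
  rw [Complex.norm_real, norm_mul, Complex.norm_real, Complex.norm_I, mul_one, Real.norm_eq_abs,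
    Real.norm_eq_abs]

/-- Norm of a `toLp 2` vector from a bound on the sum of squares: `Σ ‖v i‖² ≤ c²`, `0 ≤ c` ⇒
`‖toLp 2 v‖ ≤ c`. [folklore] -/
theorem norm_toLp_le_of_sum_sq_le {𝕜 : Type*} [RCLike 𝕜] {m : Type*} [Fintype m] (v : m → 𝕜) {c : ℝ}
    (hc : 0 ≤ c) (h : ∑ i, ‖v i‖ ^ 2 ≤ c ^ 2) : ‖(toLp 2 v : EuclideanSpace 𝕜 m)‖ ≤ c := by
  have h1 : ‖(toLp 2 v : EuclideanSpace 𝕜 m)‖ ^ 2 ≤ c ^ 2 := by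
    rw [EuclideanSpace.norm_sq_eq]
    exact h
  exact (pow_le_pow_iff_left₀ (norm_nonneg _) hc two_ne_zero).1 h1

/-- `‖Σ_j E j · u j‖ ≤ Σ_j Δ j · m j` when `‖E j‖ ≤ Δ j` and `‖u j‖ ≤ m j`. [folklore] -/
theorem norm_sum_mul_le {𝕜 : Type*} [RCLike 𝕜] {m : Type*} [Fintype m] {E u : m → 𝕜} {Δ mv : m → ℝ}
    (hE : ∀ j, ‖E j‖ ≤ Δ j) (hu : ∀ j, ‖u j‖ ≤ mv j) : ‖∑ j, E j * u j‖ ≤ ∑ j, Δ j * mv j := by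
  refine (norm_sum_le _ _).trans (Finset.sum_le_sum fun j _ ↦ ?_)
  rw [norm_mul]
  exact mul_le_mul (hE j) (hu j) (norm_nonneg _) ((norm_nonneg _).trans (hE j))

/-! ### The checker -/

/-- Residual of the centre at the test vector, real part: `Σ_j (Cre i j ure j − Cim i j uim j) − μ ure i`.
[folklore] -/
def resReQ (n : ℕ) (Cre Cim : List (List ℚ)) (ure uim : List ℚ) (μ : ℚ) (i : ℕ) : ℚ :=
  rsum n (fun j ↦ mget Cre i j * vget ure j - mget Cim i j * vget uim j) - μ * vget ure i

/-- Residual of the centre at the test vector, imaginary part: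
`Σ_j (Cre i j uim j + Cim i j ure j) − μ uim i`. [folklore] -/
def resImQ (n : ℕ) (Cre Cim : List (List ℚ)) (ure uim : List ℚ) (μ : ℚ) (i : ℕ) : ℚ :=
  rsum n (fun j ↦ mget Cre i j * vget uim j + mget Cim i j * vget ure j) - μ * vget uim i

/-- The radius contribution `Σ_i (Σ_j Δ i j (|ure j| + |uim j|))²`. [folklore] -/
def radSqQ (n : ℕ) (Δ : List (List ℚ)) (ure uim : List ℚ) : ℚ :=
  rsum n fun i ↦ (rsum n fun j ↦ mget Δ i j * (|vget ure j| + |vget uim j|)) ^ 2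

/-- `‖u‖² = Σ (ure i² + uim i²)`. [folklore] -/
def normSqQ (n : ℕ) (ure uim : List ℚ) : ℚ := rsum n fun i ↦ vget ure i ^ 2 + vget uim i ^ 2

/-- `‖(C − μ)u‖² = Σ (resRe i² + resIm i²)`. [folklore] -/
def resSqQ (n : ℕ) (Cre Cim : List (List ℚ)) (ure uim : List ℚ) (μ : ℚ) : ℚ :=
  rsum n fun i ↦ resReQ n Cre Cim ure uim μ i ^ 2 + resImQ n Cre Cim ure uim μ i ^ 2

/-- **The near-eigenvalue checker (complex Hermitian families)**: `u ≠ 0`, `ε₁, ε₂ ≥ 0`,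
`‖(C − μ)u‖² ≤ ε₁² ‖u‖²` and `Σ_i (Σ_j Δ i j m j)² ≤ ε₂² ‖u‖²`. [folklore] -/
def checkNearHerm (n : ℕ) (Cre Cim Δ : List (List ℚ)) (ure uim : List ℚ) (μ ε₁ ε₂ : ℚ) : Bool :=
  decide (0 < normSqQ n ure uim) && decide (0 ≤ ε₁) && decide (0 ≤ ε₂) &&
    decide (resSqQ n Cre Cim ure uim μ ≤ ε₁ ^ 2 * normSqQ n ure uim) &&
    decide (radSqQ n Δ ure uim ≤ ε₂ ^ 2 * normSqQ n ure uim)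

/-- The complex test vector on `Fin n`. [folklore] -/
def testV (n : ℕ) (ure uim : List ℚ) : Fin n → ℂ := fun i ↦ testC ure uim i

/-- The centre matrix on `Fin n`. [folklore] -/
def centreM (n : ℕ) (Cre Cim : List (List ℚ)) : Matrix (Fin n) (Fin n) ℂ := fun i j ↦ centreC Cre Cim i j

variable {n : ℕ}

/-- `Σ ‖u i‖² = normSqQ`. [folklore] -/
theorem sum_norm_sq_testV (ure uim : List ℚ) :
    ∑ i : Fin n, ‖testV n ure uim i‖ ^ 2 = ((normSqQ n ure uim : ℚ) : ℝ) := by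
  unfold normSqQ
  rw [rsum_eq_sum]
  push_cast
  rw [← Fin.sum_univ_eq_sum_range]
  refine Finset.sum_congr rfl fun i _ ↦ ?_
  unfold testV testC vreal
  rw [Complex.sq_norm, Complex.normSq_add_mul_I]

/-- Components of the centre residual are the rational `resReQ + i resImQ`. [folklore] -/
theorem centre_residual_apply (Cre Cim : List (List ℚ)) (ure uim : List ℚ) (μ : ℚ) (i : Fin n) :
    (centreM n Cre Cim *ᵥ testV n ure uim - (((μ : ℝ) : ℂ)) • testV n ure uim) i =
      ((resReQ n Cre Cim ure uim μ i : ℚ) : ℝ) + ((resImQ n Cre Cim ure uim μ i : ℚ) : ℝ) * Complex.I := by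
  simp only [Pi.sub_apply, Pi.smul_apply, Matrix.mulVec, dotProduct, smul_eq_mul]
  unfold resReQ resImQ centreM centreC testV testC mreal vreal
  rw [rsum_eq_sum, rsum_eq_sum]
  push_cast
  rw [← Fin.sum_univ_eq_sum_range (fun j ↦ ((mget Cre i j : ℚ) : ℂ) * ((vget ure j : ℚ) : ℂ) -
      ((mget Cim i j : ℚ) : ℂ) * ((vget uim j : ℚ) : ℂ)),
    ← Fin.sum_univ_eq_sum_range (fun j ↦ ((mget Cre i j : ℚ) : ℂ) * ((vget uim j : ℚ) : ℂ) +
      ((mget Cim i j : ℚ) : ℂ) * ((vget ure j : ℚ) : ℂ))]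
  have e : ∀ j : Fin n, (((mget Cre i j : ℚ) : ℂ) + ((mget Cim i j : ℚ) : ℂ) * Complex.I) *
      (((vget ure j : ℚ) : ℂ) + ((vget uim j : ℚ) : ℂ) * Complex.I) =
      (((mget Cre i j : ℚ) : ℂ) * ((vget ure j : ℚ) : ℂ) - ((mget Cim i j : ℚ) : ℂ) * ((vget uim j : ℚ) : ℂ)) +
      (((mget Cre i j : ℚ) : ℂ) * ((vget uim j : ℚ) : ℂ) + ((mget Cim i j : ℚ) : ℂ) * ((vget ure j : ℚ) : ℂ)) *
        Complex.I := by
    intro j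
    ring_nf
    rw [Complex.I_sq]
    ring
  simp_rw [e]
  rw [Finset.sum_add_distrib, ← Finset.sum_mul]
  ring

/-- The radius bound read in `ℝ`: `radSqQ = Σ_i (Σ_j Δ i j (|ure j| + |uim j|))²`. [folklore] -/
theorem cast_radSqQ (Δ : List (List ℚ)) (ure uim : List ℚ) :
    ((radSqQ n Δ ure uim : ℚ) : ℝ) =
      ∑ i : Fin n, (∑ j : Fin n, mreal Δ i j * (|vreal ure j| + |vreal uim j|)) ^ 2 := by
  unfold radSqQ mreal vreal
  rw [rsum_eq_sum]
  simp_rw [rsum_eq_sum]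
  push_cast
  rw [← Fin.sum_univ_eq_sum_range]
  refine Finset.sum_congr rfl fun i _ ↦ ?_
  rw [← Fin.sum_univ_eq_sum_range]

/-- **Soundness of `checkNearHerm`.** If the checker passes then every Hermitian `H` with
`‖H i j − (Cre i j + Cim i j · I)‖ ≤ Δ i j` has an eigenvalue `λ_k` with `|λ_k − μ| ≤ ε₁ + ε₂`.
[folklore] -/
theorem exists_abs_eigenvalues_sub_le_of_checkNearHerm {Cre Cim Δ : List (List ℚ)}
    {ure uim : List ℚ} {μ ε₁ ε₂ : ℚ} (h : checkNearHerm n Cre Cim Δ ure uim μ ε₁ ε₂ = true)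
    {H : Matrix (Fin n) (Fin n) ℂ} (hH : H.IsHermitian)
    (hΔ : ∀ i j : Fin n, ‖H i j - centreC Cre Cim i j‖ ≤ mreal Δ i j) :
    ∃ k, |hH.eigenvalues k - μ| ≤ ε₁ + ε₂ := by
  unfold checkNearHerm at h
  simp only [Bool.and_eq_true, decide_eq_true_eq] at h
  obtain ⟨⟨⟨⟨hnu, he1⟩, he2⟩, hres⟩, hrad⟩ := h
  set u : Fin n → ℂ := testV n ure uim with hu
  set x : EuclideanSpace ℂ (Fin n) := toLp 2 u with hx
  set G : Matrix (Fin n) (Fin n) ℂ := centreM n Cre Cim with hG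
  set r : Fin n → ℂ := G *ᵥ u - (((μ : ℝ) : ℂ)) • u with hr
  set s : Fin n → ℂ := (H - G) *ᵥ u with hs
  have he1' : (0 : ℝ) ≤ ε₁ := by exact_mod_cast he1
  have he2' : (0 : ℝ) ≤ ε₂ := by exact_mod_cast he2
  -- the norm of `x`
  have hnx : ‖x‖ ^ 2 = ((normSqQ n ure uim : ℚ) : ℝ) := by
    rw [hx, EuclideanSpace.norm_sq_eq]
    exact sum_norm_sq_testV ure uim
  have hnu' : (0 : ℝ) < ((normSqQ n ure uim : ℚ) : ℝ) := by exact_mod_cast hnu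
  have hxne : x ≠ 0 := by
    intro h0
    rw [h0, norm_zero, zero_pow two_ne_zero] at hnx
    exact absurd hnx.symm (ne_of_gt hnu')
  -- decomposition of the residual
  have hdec : toEuclideanLin H x - (((μ : ℝ) : ℂ)) • x = toLp 2 r + toLp 2 s := by
    rw [← toLp_add]
    show toLp 2 (H *ᵥ u - (((μ : ℝ) : ℂ)) • u) = _
    congr 1
    rw [hs, Matrix.sub_mulVec, hr]
    abel
  -- the centre residual
  have hr_le : ‖(toLp 2 r : EuclideanSpace ℂ (Fin n))‖ ≤ ε₁ * ‖x‖ := by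
    refine norm_toLp_le_of_sum_sq_le r (mul_nonneg he1' (norm_nonneg _)) ?_
    have e : ∑ i, ‖r i‖ ^ 2 = ((resSqQ n Cre Cim ure uim μ : ℚ) : ℝ) := by
      unfold resSqQ
      rw [rsum_eq_sum]
      push_cast
      rw [← Fin.sum_univ_eq_sum_range]
      refine Finset.sum_congr rfl fun i _ ↦ ?_
      rw [hr, hG, hu, centre_residual_apply, Complex.sq_norm, Complex.normSq_add_mul_I]
    rw [e, mul_pow, hnx]
    exact_mod_cast hres
  -- the radius part
  have hs_le : ‖(toLp 2 s : EuclideanSpace ℂ (Fin n))‖ ≤ ε₂ * ‖x‖ := by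
    refine norm_toLp_le_of_sum_sq_le s (mul_nonneg he2' (norm_nonneg _)) ?_
    have hcomp : ∀ i : Fin n, ‖s i‖ ≤ ∑ j : Fin n, mreal Δ i j * (|vreal ure j| + |vreal uim j|) := by
      intro i
      rw [hs]
      simp only [Matrix.mulVec, dotProduct, Matrix.sub_apply]
      refine norm_sum_mul_le (fun j ↦ ?_) (fun j ↦ norm_complex_le_abs_add_abs _ _)
      exact hΔ i j
    have h1 : ∑ i, ‖s i‖ ^ 2 ≤ ∑ i : Fin n, (∑ j : Fin n, mreal Δ i j * (|vreal ure j| + |vreal uim j|)) ^ 2 :=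
      Finset.sum_le_sum fun i _ ↦ pow_le_pow_left₀ (norm_nonneg _) (hcomp i) 2
    refine h1.trans ?_
    rw [← cast_radSqQ, mul_pow, hnx]
    exact_mod_cast hrad
  -- assemble
  have hbound : ‖toEuclideanLin H x - (((μ : ℝ) : ℂ)) • x‖ ≤ (ε₁ + ε₂ : ℝ) * ‖x‖ := by
    rw [hdec]
    refine (norm_add_le _ _).trans ?_
    rw [add_mul]
    exact add_le_add hr_le hs_le
  obtain ⟨k, hk⟩ := exists_abs_eigenvalues_sub_le_of_norm_residual_le hH (μ : ℝ) hxne hbound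
  exact ⟨k, hk⟩

/-! ### Real symmetric families -/

/-- **The near-eigenvalue checker for real symmetric families**: the complex checker with empty
imaginary tables. [folklore] -/
def checkNear (n : ℕ) (C Δ : List (List ℚ)) (u : List ℚ) (μ ε₁ ε₂ : ℚ) : Bool :=
  checkNearHerm n C [] Δ u [] μ ε₁ ε₂

/-- The real test vector on `Fin n`. [folklore] -/
def testVR (n : ℕ) (u : List ℚ) : Fin n → ℝ := fun i ↦ vreal u i

/-- The real centre matrix on `Fin n`. [folklore] -/
def centreMR (n : ℕ) (C : List (List ℚ)) : Matrix (Fin n) (Fin n) ℝ := fun i j ↦ mreal C i j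

/-- `Σ (u i)² = normSqQ n u []`. [folklore] -/
theorem sum_sq_testVR (u : List ℚ) : ∑ i : Fin n, ‖testVR n u i‖ ^ 2 = ((normSqQ n u [] : ℚ) : ℝ) := by
  unfold normSqQ
  rw [rsum_eq_sum]
  push_cast
  rw [← Fin.sum_univ_eq_sum_range]
  refine Finset.sum_congr rfl fun i _ ↦ ?_
  rw [Real.norm_eq_abs, sq_abs]
  simp [testVR, vreal, vget_nil]

/-- Components of the real centre residual are the rational `resReQ` (with empty imaginary data).
[folklore] -/
theorem centre_residual_apply_real (C : List (List ℚ)) (u : List ℚ) (μ : ℚ) (i : Fin n) :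
    (centreMR n C *ᵥ testVR n u - (μ : ℝ) • testVR n u) i = ((resReQ n C [] u [] μ i : ℚ) : ℝ) := by
  simp only [Pi.sub_apply, Pi.smul_apply, Matrix.mulVec, dotProduct, smul_eq_mul]
  unfold resReQ centreMR testVR mreal vreal
  rw [rsum_eq_sum]
  push_cast
  rw [← Fin.sum_univ_eq_sum_range]
  simp [mget, vget_nil]

/-- **Soundness of `checkNear` (real symmetric families).** If the checker passes then every symmetric
real `A` with `|A i j − C i j| ≤ Δ i j` has an eigenvalue `λ_k` with `|λ_k − μ| ≤ ε₁ + ε₂`. [folklore] -/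
theorem exists_abs_eigenvalues_sub_le_of_checkNear {C Δ : List (List ℚ)} {u : List ℚ} {μ ε₁ ε₂ : ℚ}
    (h : checkNear n C Δ u μ ε₁ ε₂ = true) {A : Matrix (Fin n) (Fin n) ℝ} (hA : A.IsHermitian)
    (hΔ : ∀ i j : Fin n, |A i j - mreal C i j| ≤ mreal Δ i j) :
    ∃ k, |hA.eigenvalues k - μ| ≤ ε₁ + ε₂ := by
  unfold checkNear checkNearHerm at h
  simp only [Bool.and_eq_true, decide_eq_true_eq] at h
  obtain ⟨⟨⟨⟨hnu, he1⟩, he2⟩, hres⟩, hrad⟩ := h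
  set v : Fin n → ℝ := testVR n u with hv
  set x : EuclideanSpace ℝ (Fin n) := toLp 2 v with hx
  set G : Matrix (Fin n) (Fin n) ℝ := centreMR n C with hG
  set r : Fin n → ℝ := G *ᵥ v - (μ : ℝ) • v with hr
  set s : Fin n → ℝ := (A - G) *ᵥ v with hs
  have he1' : (0 : ℝ) ≤ ε₁ := by exact_mod_cast he1
  have he2' : (0 : ℝ) ≤ ε₂ := by exact_mod_cast he2
  have hnx : ‖x‖ ^ 2 = ((normSqQ n u [] : ℚ) : ℝ) := by
    rw [hx, EuclideanSpace.norm_sq_eq]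
    exact sum_sq_testVR u
  have hnu' : (0 : ℝ) < ((normSqQ n u [] : ℚ) : ℝ) := by exact_mod_cast hnu
  have hxne : x ≠ 0 := by
    intro h0
    rw [h0, norm_zero, zero_pow two_ne_zero] at hnx
    exact absurd hnx.symm (ne_of_gt hnu')
  have hdec : toEuclideanLin A x - ((μ : ℚ) : ℝ) • x = toLp 2 r + toLp 2 s := by
    rw [← toLp_add]
    show toLp 2 (A *ᵥ v - ((μ : ℚ) : ℝ) • v) = _
    congr 1
    rw [hs, Matrix.sub_mulVec, hr]
    abel
  have hr_le : ‖(toLp 2 r : EuclideanSpace ℝ (Fin n))‖ ≤ ε₁ * ‖x‖ := by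
    refine norm_toLp_le_of_sum_sq_le r (mul_nonneg he1' (norm_nonneg _)) ?_
    have e : ∑ i, ‖r i‖ ^ 2 ≤ ((resSqQ n C [] u [] μ : ℚ) : ℝ) := by
      unfold resSqQ
      rw [rsum_eq_sum]
      push_cast
      rw [← Fin.sum_univ_eq_sum_range]
      refine Finset.sum_le_sum fun i _ ↦ ?_
      rw [hr, hG, hv, centre_residual_apply_real, Real.norm_eq_abs, sq_abs]
      nlinarith [sq_nonneg ((resImQ n C [] u [] μ i : ℚ) : ℝ)]
    refine e.trans ?_
    rw [mul_pow, hnx]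
    exact_mod_cast hres
  have hs_le : ‖(toLp 2 s : EuclideanSpace ℝ (Fin n))‖ ≤ ε₂ * ‖x‖ := by
    refine norm_toLp_le_of_sum_sq_le s (mul_nonneg he2' (norm_nonneg _)) ?_
    have hcomp : ∀ i : Fin n, ‖s i‖ ≤ ∑ j : Fin n, mreal Δ i j * (|vreal u j| + |vreal ([] : List ℚ) j|) := by
      intro i
      rw [hs]
      simp only [Matrix.mulVec, dotProduct, Matrix.sub_apply]
      refine norm_sum_mul_le (fun j ↦ ?_) (fun j ↦ ?_)
      · rw [Real.norm_eq_abs]; exact hΔ i j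
      · rw [hv, testVR, Real.norm_eq_abs]
        exact le_add_of_nonneg_right (abs_nonneg _)
    have h1 : ∑ i, ‖s i‖ ^ 2 ≤ ∑ i : Fin n, (∑ j : Fin n, mreal Δ i j * (|vreal u j| + |vreal ([] : List ℚ) j|)) ^ 2 :=
      Finset.sum_le_sum fun i _ ↦ pow_le_pow_left₀ (norm_nonneg _) (hcomp i) 2
    refine h1.trans ?_
    rw [← cast_radSqQ, mul_pow, hnx]
    exact_mod_cast hrad
  have hbound : ‖toEuclideanLin A x - ((μ : ℚ) : ℝ) • x‖ ≤ (ε₁ + ε₂ : ℝ) * ‖x‖ := by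
    rw [hdec]
    refine (norm_add_le _ _).trans ?_
    rw [add_mul]
    exact add_le_add hr_le hs_le
  obtain ⟨k, hk⟩ := exists_abs_eigenvalues_sub_le_of_norm_residual_le hA (μ : ℝ) hxne
    (by simpa using hbound)
  exact ⟨k, hk⟩

/-- Kernel example: `C = [[2, 1], [1, 2]]` exact, `μ = 3`, `u = (1, 1)`: residual `0`, so every
symmetric matrix within `1/100` of `C` entrywise has an eigenvalue in `[3 − 1/50, 3 + 1/50]`
(`ε₂ = 1/50`: `Σ_i (Σ_j Δ i j · 1)² = 2 · (2/100)² ≤ (1/50)² · 2`). -/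
example : checkNear 2 [[2, 1], [1, 2]] [[1/100, 1/100], [1/100, 1/100]] [1, 1] 3 0 (1/50) = true := by
  decide +kernel

end Literature.Analysis.ValidatedNumerics

end
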